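import Summits.ResolutionOfSingularities.ResolutionOfSingularities.Theorems.FrobeniusLadderFInjectiveMacaulayficationCNConeFiModelRelBlowup
import Literature.AlgebraicGeometry.Resolution.AffineBlowupIntegral
import HarnessLib

/-!
# THE FIRST STRONG⁺ PRODUCER IN THE KERNEL: the relative CN engine (H3-rel) as a confined iso-step at the generic point of the
# stratum `V(X_J) ∩ Spec k[X]/(f)` — the ∃-clause of `stub_confinedIsoStepStrongPlus` VERBATIM for `X₁ = Spec k[X]/(f)`
# (crux `FInjectiveMacaulayfication` stmt-ResolutionOfSingularities-15315, chain w45a, hole #3; CRUX-PLAN v7 §3 «PRODUCERS», R7.5)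

Support file for crux stmt-ResolutionOfSingularities-15315 (`FrobeniusLadder.FInjectiveMacaulayfication`), chain w45a, seat
res-D-pv-017 AS res-L1-w45a-stub-5. [OURS · L1 W4.5a] — NOT a statement of any manuscript; AI-written, weaker than expert review.

Hole #3 of the skeleton (v19 `02fcd730`) is the LOCAL STRONG⁺ STEP `stub_confinedIsoStepStrongPlus`: at a point `η` of an integral
everywhere-CM `X₁`, a proper birational `π : X₂ ⟶ X₁` with `X₂` integral and everywhere CM, `π` an isomorphism EXACTLY off
`closure {η}`, and the full clause (domain ∧ CM ∧ Frobenius-closed parameter ideals) at the non-closed points of `X₂` over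
`closure {η}`. This file PRODUCES such a step for `X₁ = Spec k[X]/(f)` and `η` the generic point of the coordinate stratum
`V(x̄ⱼ : j ∈ J)` (asked to be a point, i.e. `(x̄ⱼ : j ∈ J)` prime — automatic when `f ∈ (X_J)`), from the data of the relative CN engine
(H3-rel) `CNConeFiModelRel.cnConeFiModelRel` (p497132): the step is the blow-up of the `J`-supported monomial ideal `I_A R`, and

* it is an isomorphism off `V(I_A R)` (Stacks 02OS; tree `affineBlowup.isIso_morphismRestrict_iSup` + `iSup_basicOpen_eq_compl_zeroLocus`),
  and `V(I_A R) = V(x̄ⱼ : j ∈ J) = closure {η}` because every generator of `A` involves a `J`-variable and `A ∋ X_j^e` for `j ∈ J`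
  (`centre_le_iff`: a prime contains `I_A R` iff it contains `(x̄ⱼ : j ∈ J)`);
* it is integral (Stacks 02ND; tree `affineBlowup.isIntegral`), proper, birational (`affineBlowup.isBirational`);
* EVERY stalk is a CM domain with Frobenius-closed parameter ideals (`CNConeFiModelRelBlowup.affineBlowup_fiClause_of_cnData`),
  in particular at the non-closed points over `closure {η}` — the residual is EMPTY.

`strongPlusStep_of_cnData` states exactly the ∃-clause of `stub_confinedIsoStepStrongPlus` (its seven conjuncts, same order, same
spelling) for this `X₁` and `η`. It does not use the STRONG⁺ antecedents (badness at `η`, goodness at the proper generizations):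
the CN data force the conclusion outright. No definitions, no named facts. [folklore; cite: StacksProject, Tags 02OS, 02ND]
-/

-- single-problem summit: the doubled namespace component is forced
set_option linter.dupNamespace false

noncomputable section

open AlgebraicGeometry CategoryTheory Literature.AlgebraicGeometry.Resolution MvPolynomial

namespace Summit.ResolutionOfSingularities.ResolutionOfSingularities.Theorems.FInjectiveMacaulayfication.CNStrongPlusStepRel

open Summit.ResolutionOfSingularities.ResolutionOfSingularities.Theorems.FInjectiveMacaulayfication

/-! ## §1 The support of the centre is the stratum -/

/-- **A prime contains `I_A R` iff it contains `(x̄ⱼ : j ∈ J)`** in `k[X]/(f)` (so `V(I_A R) = V(x̄ⱼ : j ∈ J)`): `→` because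
`X_j^e ∈ A` for `j ∈ J` ((prim) on `J`) and `P` is prime; `←` because every exponent of `A` involves a `J`-variable, so
`I_A R ⊆ (x̄ⱼ : j ∈ J)`. [folklore] -/
theorem centre_le_iff {k : Type} [Field k] {n : ℕ} (J : Finset (Fin n)) (A : Finset (Fin n →₀ ℕ))
    (hAJ : ∀ a ∈ A, ∃ j ∈ J, 0 < a j) (hprim : ∀ j ∈ J, ∃ e : ℕ, 0 < e ∧ Finsupp.single j e ∈ A)
    (f : MvPolynomial (Fin n) k) (P : Ideal (MvPolynomial (Fin n) k ⧸ Ideal.span {f})) [P.IsPrime] :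
    Ideal.span ((fun b : Fin n →₀ ℕ => Ideal.Quotient.mk (Ideal.span {f}) (MvPolynomial.monomial b (1 : k))) '' (A : Set (Fin n →₀ ℕ))) ≤ P ↔
      Ideal.span ((fun j : Fin n => Ideal.Quotient.mk (Ideal.span {f}) (X j)) '' (J : Set (Fin n))) ≤ P := by
  constructor
  · -- `X_j^e ∈ I_A ⊆ P` and `P` prime ⇒ `x̄ⱼ ∈ P`
    intro hP
    rw [Ideal.span_le]
    rintro _ ⟨j, hj, rfl⟩
    obtain ⟨e, he, heA⟩ := hprim j hj
    have hmem : Ideal.Quotient.mk (Ideal.span {f}) (MvPolynomial.X j) ^ e ∈ P := by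
      refine hP (Ideal.subset_span ⟨Finsupp.single j e, heA, ?_⟩)
      show Ideal.Quotient.mk (Ideal.span {f}) (MvPolynomial.monomial (Finsupp.single j e) (1 : k)) = _
      rw [← map_pow, X_pow_eq_monomial]
    exact (inferInstance : P.IsPrime).mem_of_pow_mem _ hmem
  · -- every generator of `A` involves a `J`-variable
    intro hP
    rw [Ideal.span_le]
    rintro _ ⟨b, hb, rfl⟩
    obtain ⟨j, hj, hbj⟩ := hAJ b hb
    have hXj : Ideal.Quotient.mk (Ideal.span {f}) (X j) ∈ P := hP (Ideal.subset_span ⟨j, hj, rfl⟩)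
    have hle : Finsupp.single j 1 ≤ b := by
      rw [Finsupp.single_le_iff]
      exact hbj
    have heq : (MvPolynomial.monomial b (1 : k) : MvPolynomial (Fin n) k) =
        MvPolynomial.monomial (b - Finsupp.single j 1) (1 : k) * X j := by
      rw [X, monomial_mul, mul_one, tsub_add_cancel_of_le hle]
    show Ideal.Quotient.mk (Ideal.span {f}) (MvPolynomial.monomial b (1 : k)) ∈ P
    rw [heq, map_mul]
    exact P.mul_mem_left _ hXj

/-! ## §2 The STRONG⁺ step at the generic point of the stratum -/

set_option maxHeartbeats 800000 in
/-- **THE RELATIVE CN ENGINE IS A STRONG⁺ CONFINED ISO-STEP AT THE GENERIC POINT OF ITS STRATUM (empty residual).** Data: exactly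
those of (H3-rel) `CNConeFiModelRel.cnConeFiModelRel` (p497132) — `J ≠ ∅`, the `J`-supported monomial centre `A` with (prim) on `J`,
unimodular covering vertex charts, `(f)` prime with no `x̄ⱼ = 0`, the clause at the maximal ideals off `V(X_J)`, the Cartier–Newton
faces positive on `J`, the strict transforms `θ_c f = y^(dv c) g_c` with no `yᵢ ∣ g_c` and a simultaneous minimiser — and a point
`η` of `Spec k[X]/(f)` whose prime is `(x̄ⱼ : j ∈ J)` (the generic point of the stratum). CONCLUSION: the ∃-clause of
`stub_confinedIsoStepStrongPlus` VERBATIM for `X₁ = Spec k[X]/(f)` — `X₂ = Bl_(I_A R)`, proper, birational, integral, everywhere CM,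
an isomorphism exactly off `closure {η} = V(I_A R)`, and domain ∧ CM ∧ Frobenius-closed parameter ideals at (all, in particular the
non-closed) points over `closure {η}`. [cite: StacksProject, Tags 02OS, 02ND] -/
theorem strongPlusStep_of_cnData (p : ℕ) [Fact p.Prime] (k : Type) [Field k] [CharP k p] (n : ℕ) (J : Finset (Fin n))
    (hJ : J.Nonempty) (A : Finset (Fin n →₀ ℕ)) (hAJ : ∀ a ∈ A, ∃ j ∈ J, 0 < a j)
    (hprim : ∀ j ∈ J, ∃ e : ℕ, 0 < e ∧ Finsupp.single j e ∈ A)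
    (t : ℕ) (ht : 0 < t) (V : Fin t → Matrix (Fin n) (Fin n) ℕ) (hV : ∀ c, IsUnit ((V c).map (Nat.cast : ℕ → ℤ)).det)
    (m : Fin t → (Fin n →₀ ℕ)) (hm : ∀ c, m c ∈ A) (a : Fin t → Fin n → (Fin n →₀ ℕ)) (haA : ∀ c i, a c i ∈ A)
    (hgen : ∀ (c : Fin t) (i : Fin n), (Finsupp.equivFunOnFinite.symm ((V c).mulVec ⇑(a c i)) : Fin n →₀ ℕ) =
      Finsupp.equivFunOnFinite.symm ((V c).mulVec ⇑(m c)) + Finsupp.single i 1)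
    (hge : ∀ (c : Fin t), ∀ e ∈ A, (Finsupp.equivFunOnFinite.symm ((V c).mulVec ⇑(m c)) : Fin n →₀ ℕ) ≤
      Finsupp.equivFunOnFinite.symm ((V c).mulVec ⇑e))
    (hcov : ∀ e ∈ A, ∃ (c : Fin t) (K : ℕ), 1 ≤ K ∧ ∃ y ∈ (Ideal.span ((fun b : Fin n →₀ ℕ => (MvPolynomial.monomial b (1 : k) : MvPolynomial (Fin n) k)) '' (A : Set (Fin n →₀ ℕ)))) ^ (K - 1),
      (MvPolynomial.monomial e (1 : k) : MvPolynomial (Fin n) k) ^ K = MvPolynomial.monomial (m c) 1 * y)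
    (f : MvPolynomial (Fin n) k) (hfprime : (Ideal.span {f}).IsPrime)
    (hXne : ∀ v : Fin n, Ideal.Quotient.mk (Ideal.span {f}) (MvPolynomial.X v) ≠ 0)
    (hoff : ∀ (Q : Ideal (MvPolynomial (Fin n) k ⧸ Ideal.span {f})) [Q.IsMaximal],
      (∃ j ∈ J, Ideal.Quotient.mk (Ideal.span {f}) (MvPolynomial.X j) ∉ Q) →
      ∀ d : ℕ, ringKrullDim (Localization.AtPrime Q) = d → ∀ s : Fin d → Localization.AtPrime Q,
        (Ideal.span (Set.range s)).radical.IsMaximal →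
          RingTheory.Sequence.IsWeaklyRegular (Localization.AtPrime Q) (List.ofFn s) ∧
          ∀ y : Localization.AtPrime Q, (∃ e : ℕ, y ^ p ^ e ∈ Ideal.span
            ((fun z : Localization.AtPrime Q => z ^ p ^ e) ''
              (Ideal.span (Set.range s) : Set (Localization.AtPrime Q)))) → y ∈ Ideal.span (Set.range s))
    (hCN : ∀ (c : Fin t) (S : Finset (Fin n)), (∀ j ∈ J, 0 < ∑ i ∈ S, V c i j) →
      (∀ D : ℕ, (MvPolynomial.weightedHomogeneousComponent (fun j : Fin n => ∑ i ∈ S, V c i j) D f ≠ 0 ∧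
          ∀ D' < D, MvPolynomial.weightedHomogeneousComponent (fun j : Fin n => ∑ i ∈ S, V c i j) D' f = 0) →
        ∀ (K : Type) [Field K] [Algebra k K] (b : Fin n → K), (∀ i, b i ≠ 0) →
          MvPolynomial.aeval b (MvPolynomial.weightedHomogeneousComponent (fun j : Fin n => ∑ i ∈ S, V c i j) D f) = 0 →
          (MvPolynomial.map (algebraMap k K) (MvPolynomial.weightedHomogeneousComponent (fun j : Fin n => ∑ i ∈ S, V c i j) D f)) ^ (p - 1) ∉
            Ideal.span (Set.range fun i : Fin n => (MvPolynomial.X i - MvPolynomial.C (b i)) ^ p)))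
    (dv : Fin t → (Fin n →₀ ℕ)) (g : Fin t → MvPolynomial (Fin n) k)
    (hg : ∀ c, MvPolynomial.aeval (fun j : Fin n => ∏ i : Fin n, (MvPolynomial.X i : MvPolynomial (Fin n) k) ^ V c i j) f = MvPolynomial.monomial (dv c) 1 * g c)
    (hndiv : ∀ c, ∀ i : Fin n, ¬ (MvPolynomial.X i ∣ g c))
    (hface : ∀ c, ∃ m ∈ f.support, ∀ i : Fin n, ∑ j : Fin n, V c i j * m j = dv c i)
    (η : ↥(Spec (.of (MvPolynomial (Fin n) k ⧸ Ideal.span {f}))))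
    (hη : η.asIdeal = Ideal.span ((fun j : Fin n => Ideal.Quotient.mk (Ideal.span {f}) (X j)) '' (J : Set (Fin n)))) :
    ∃ (X₂ : Scheme.{0}) (π : X₂ ⟶ Spec (.of (MvPolynomial (Fin n) k ⧸ Ideal.span {f}))), IsProper π ∧
      Literature.AlgebraicGeometry.Resolution.IsBirational π ∧
      IsIntegral X₂ ∧ (∀ x : X₂, (∀ d : ℕ, ringKrullDim (X₂.presheaf.stalk x) = d → ∀ s : Fin d → X₂.presheaf.stalk x, (Ideal.span (Set.range s)).radical.IsMaximal → RingTheory.Sequence.IsWeaklyRegular (X₂.presheaf.stalk x) (List.ofFn s))) ∧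
      IsIso (π ∣_ ⟨(closure ({η} : Set ↥(Spec (.of (MvPolynomial (Fin n) k ⧸ Ideal.span {f})))))ᶜ, isClosed_closure.isOpen_compl⟩) ∧
      ∀ x : X₂, π.base x ∈ closure ({η} : Set ↥(Spec (.of (MvPolynomial (Fin n) k ⧸ Ideal.span {f})))) → ¬ IsClosed ({x} : Set X₂) → (IsDomain (X₂.presheaf.stalk x) ∧ ∀ d : ℕ, ringKrullDim (X₂.presheaf.stalk x) = d → ∀ s : Fin d → X₂.presheaf.stalk x, (Ideal.span (Set.range s)).radical.IsMaximal → RingTheory.Sequence.IsWeaklyRegular (X₂.presheaf.stalk x) (List.ofFn s) ∧ ∀ t : X₂.presheaf.stalk x, (∃ e : ℕ, t ^ p ^ e ∈ Ideal.span ((fun z : X₂.presheaf.stalk x => z ^ p ^ e) '' (Ideal.span (Set.range s) : Set (X₂.presheaf.stalk x)))) → t ∈ Ideal.span (Set.range s)) := by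
  haveI := hfprime
  haveI : IsDomain (MvPolynomial (Fin n) k ⧸ Ideal.span {f}) := Ideal.Quotient.isDomain _
  haveI : CharP (MvPolynomial (Fin n) k ⧸ Ideal.span {f}) p :=
    charP_of_injective_algebraMap (algebraMap k (MvPolynomial (Fin n) k ⧸ Ideal.span {f})).injective p
  -- the centre `I = I_A · R`
  set I : Ideal (MvPolynomial (Fin n) k ⧸ Ideal.span {f}) :=
    Ideal.span ((fun b : Fin n →₀ ℕ => Ideal.Quotient.mk (Ideal.span {f}) (MvPolynomial.monomial b (1 : k))) '' (A : Set (Fin n →₀ ℕ))) with hI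
  have hI0 : I ≠ ⊥ := by
    intro h
    have hmem : Ideal.Quotient.mk (Ideal.span {f}) (MvPolynomial.monomial (m ⟨0, ht⟩) (1 : k)) ∈ I :=
      Ideal.subset_span ⟨m ⟨0, ht⟩, hm ⟨0, ht⟩, rfl⟩
    rw [h, Ideal.mem_bot] at hmem
    exact CNConeFiModel.mk_monomial_ne_zero f hXne (m ⟨0, ht⟩) hmem
  -- every stalk of the blow-up is a CM domain with Frobenius-closed parameter ideals
  have hcl := CNConeFiModelRelBlowup.affineBlowup_fiClause_of_cnData p k n J hJ A hAJ hprim t ht V hV m hm a haA hgen hge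
    hcov f hfprime hXne hoff hCN dv g hg hndiv hface I hI
  -- the complement of `closure {η}` is the open `⋃_(a ∈ I) D(a)` (`closure {η} = V(η) = V(I)`)
  have key : ∀ x : ↥(Spec (.of (MvPolynomial (Fin n) k ⧸ Ideal.span {f}))),
      x ∈ closure ({η} : Set ↥(Spec (.of (MvPolynomial (Fin n) k ⧸ Ideal.span {f})))) ↔ I ≤ x.asIdeal := by
    intro x
    refine specializes_iff_mem_closure.symm.trans ?_
    refine (PrimeSpectrum.le_iff_specializes η x).symm.trans ?_
    change η.asIdeal ≤ x.asIdeal ↔ I ≤ x.asIdeal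
    constructor
    · intro h
      exact (centre_le_iff J A hAJ hprim f x.asIdeal).mpr (hη.symm.le.trans h)
    · intro h
      exact hη.le.trans ((centre_le_iff J A hAJ hprim f x.asIdeal).mp h)
  have hU : (⟨(closure ({η} : Set ↥(Spec (.of (MvPolynomial (Fin n) k ⧸ Ideal.span {f})))))ᶜ, isClosed_closure.isOpen_compl⟩ :
      (Spec (.of (MvPolynomial (Fin n) k ⧸ Ideal.span {f}))).Opens) =
      ⨆ a : I, (PrimeSpectrum.basicOpen (a : MvPolynomial (Fin n) k ⧸ Ideal.span {f}) : (Spec (.of (MvPolynomial (Fin n) k ⧸ Ideal.span {f}))).Opens) := by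
    apply TopologicalSpace.Opens.ext
    ext x
    constructor
    · intro hx
      have hx' : ¬ I ≤ x.asIdeal := fun hle => hx ((key x).mpr hle)
      by_contra hcon
      apply hx'
      intro r hr
      by_contra hrx
      exact hcon (TopologicalSpace.Opens.mem_iSup.mpr ⟨⟨r, hr⟩, (PrimeSpectrum.mem_basicOpen _ _).mpr hrx⟩)
    · intro hx
      show x ∉ closure ({η} : Set ↥(Spec (.of (MvPolynomial (Fin n) k ⧸ Ideal.span {f}))))
      intro hxc
      obtain ⟨r, hr⟩ := TopologicalSpace.Opens.mem_iSup.mp hx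
      exact (PrimeSpectrum.mem_basicOpen _ _).mp hr (((key x).mp hxc) r.2)
  have hiso : IsIso (affineBlowup.π I ∣_ ⟨(closure ({η} : Set ↥(Spec (.of (MvPolynomial (Fin n) k ⧸ Ideal.span {f})))))ᶜ,
      isClosed_closure.isOpen_compl⟩) := by
    rw [hU]
    exact affineBlowup.isIso_morphismRestrict_iSup
  refine ⟨affineBlowup I, affineBlowup.π I, inferInstance, affineBlowup.isBirational hI0, affineBlowup.isIntegral hI0,
    fun x d hd s hs => ((hcl x).2 d hd s hs).1, hiso, fun x _ _ => ⟨(hcl x).1, fun d hd s hs => (hcl x).2 d hd s hs⟩⟩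

end Summit.ResolutionOfSingularities.ResolutionOfSingularities.Theorems.FInjectiveMacaulayfication.CNStrongPlusStepRel

end
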